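import Mathlib
import Literature.Geometry.Symplectic.JHolomorphicMap
import Summits.SmoothPoincare4.SmoothPoincare4.Theorems.SullivanDualTameOrBrodyR4PencilDefs
import Summits.SmoothPoincare4.SmoothPoincare4.Theorems.SullivanDualTameOrBrodyR4StubFarInverse

/-!
# The standard model of the anchored-pencil vocabulary (crux `TameOrBrodyR4`, stmt-SmoothPoincare4-7826, line `Sketch` — lead prover file)

NON-VACUITY / SANITY CERTIFICATE for the four deep predicates of
`Theorems/SullivanDualTameOrBrodyR4PencilDefs.lean` (the research inputs `stub_localFamily`,
`stub_uniqueDisjoint`, `stub_embeddedLimits`, `stub_transverse` of the line skeleton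
`Cruxes/TameOrBrodyR4/Lines/Sketch.lean`): for an almost complex structure which is STANDARD
EVERYWHERE in the frame (`P ∘ J_x = i P`, `Q ∘ J_x = i Q` for all `x` — e.g. the constant structure
`J₀ = eP ∘ i ∘ P + eQ ∘ i ∘ Q` of `StandardModel.exists_standard_structure`, for every frame), Liouville's
theorem shows that the normalised members are EXACTLY the flat planes `ξ ↦ eP ξ + eQ b`
(`StandardModel.eq_flat`, `StandardModel.memberFlat`), and then all four predicates hold:
`HasLocalFamilies` (the flat planes form the jointly smooth family, parameter derivative `eQ β`
never tangent to `range eP`), `HasUniqueDisjointMembers`, `HasEmbeddedLimits` (a normalised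
`J`-holomorphic limit has `P ∘ v = id`), `HasTransverseMembers` (`range eP ∩ range eQ = 0`)
— registered helper `helper_standardModel`. So the deep stubs are satisfiable with the intended
witnesses and their quantifier structure is the right one (in particular the `β = 0` /
`ζ = 0` transversality clauses), which is what a refuter would otherwise have to check first.

References: M. Gromov, Invent. Math. 82 (1985), §2.4.A (for the integrable `J₀` the two pencils
are the coordinate foliations).
-/

-- the registered namespace `Summit.SmoothPoincare4.SmoothPoincare4.…` repeats a component
set_option linter.dupNamespace false

noncomputable section

open scoped ContDiff Topology
open Filter Set Metric Literature.Geometry.Symplectic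

namespace Summit.SmoothPoincare4.SmoothPoincare4.Cruxes.TameOrBrodyR4.Sketch

/-- Local notation for the model space `ℝ⁴ = EuclideanSpace ℝ (Fin 4)`. -/
local notation "E4" => EuclideanSpace ℝ (Fin 4)

namespace StandardModel

/-- **Liouville: for a globally standard `J`, normalised asymptotically flat `J`-holomorphic planes
are flat.** If `P ∘ J_x = i P` and `Q ∘ J_x = i Q` everywhere, a `C^∞` flat-`J`-holomorphic `u`
with `Q (u ξ) → b` and `P (u ξ) - ξ → 0` at infinity is `ξ ↦ eP ξ + eQ b` (both coordinates are
entire; `P ∘ u - id` and `Q ∘ u` have limits at infinity, hence are constant). -/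
theorem eq_flat (J : E4 → E4 →L[ℝ] E4) (P Q : E4 →L[ℝ] ℂ) (eP eQ : ℂ →L[ℝ] E4)
    (hPQ : IsCoordFrame P Q eP eQ) (hJP : ∀ x v : E4, P (J x v) = Complex.I * P v)
    (hJQ : ∀ x v : E4, Q (J x v) = Complex.I * Q v) {u : ℂ → E4} (hu : ContDiff ℝ ∞ u)
    (huJ : IsJHolomorphicFlat J u) {b : ℂ} (h5 : Tendsto (fun ξ => Q (u ξ)) (cocompact ℂ) (𝓝 b))
    (h6 : Tendsto (fun ξ => P (u ξ) - ξ) (cocompact ℂ) (𝓝 0)) :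
    u = fun ξ => eP ξ + eQ b := by
  have hud : Differentiable ℝ u := hu.differentiable (by simp)
  have hP : Differentiable ℂ (fun ξ => P (u ξ)) := fun ξ =>
    FarInverse.differentiableAt_comp J 0 P (fun x _ v => hJP x v) u hud huJ ξ (norm_nonneg _)
  have hQ : Differentiable ℂ (fun ξ => Q (u ξ)) := fun ξ =>
    FarInverse.differentiableAt_comp J 0 Q (fun x _ v => hJQ x v) u hud huJ ξ (norm_nonneg _)
  have hPid : ∀ ξ, P (u ξ) = ξ := fun ξ =>
    sub_eq_zero.mp ((hP.sub differentiable_id).apply_eq_of_tendsto_cocompact ξ h6)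
  have hQb : ∀ ξ, Q (u ξ) = b := fun ξ => hQ.apply_eq_of_tendsto_cocompact ξ h5
  funext ξ
  rw [← hPQ.2.2.2.2.2 (u ξ), hQb, hPid]

/-- For a globally standard `J` every flat plane `ξ ↦ eP ξ + eQ b` is a member, for every `b`. -/
theorem memberFlat (J : E4 → E4 →L[ℝ] E4) (R : ℝ) (P Q : E4 →L[ℝ] ℂ) (eP eQ : ℂ →L[ℝ] E4)
    (hPQ : IsCoordFrame P Q eP eQ) (hJP : ∀ x v : E4, P (J x v) = Complex.I * P v)
    (hJQ : ∀ x v : E4, Q (J x v) = Complex.I * Q v) (b : ℂ) :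
    IsPencilMember J R P Q b (fun ξ => eP ξ + eQ b) := by
  obtain ⟨-, hPeP, hQeP, hPeQ, hQeQ, -⟩ := id hPQ
  have hPu : ∀ ξ : ℂ, P (eP ξ + eQ b) = ξ := fun ξ => by rw [map_add, hPeP, hPeQ, add_zero]
  have hQu : ∀ ξ : ℂ, Q (eP ξ + eQ b) = b := fun ξ => by rw [map_add, hQeP, hQeQ, zero_add]
  have hd : ∀ ξ : ℂ, fderiv ℝ (fun ξ => eP ξ + eQ b) ξ = eP := fun ξ =>
    ((eP.hasFDerivAt).add_const (eQ b)).fderiv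
  have hPid : (fun ξ => P (eP ξ + eQ b)) = id := funext hPu
  refine ⟨eP.contDiff.add contDiff_const, ?_, ?_, ?_, ?_, ?_, ?_, ?_⟩
  · intro z ζ
    rw [hd]
    refine PencilDefs.eq_of_apply_eq hPQ ?_ ?_
    · rw [hJP, hPeP, hPeP]
    · rw [hJQ, hQeP, hQeP, mul_zero]
  · intro ξ ξ' h
    have := congrArg P h
    rwa [hPu, hPu] at this
  · intro ξ ζ ζ' h
    rw [hd] at h
    have := congrArg P h
    rwa [hPeP, hPeP] at this
  · simp only [hQu]; exact tendsto_const_nhds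
  · simp only [hPu, sub_self]; exact tendsto_const_nhds
  · intro c _
    exact ⟨c, hPu c, fun ξ h => by simpa only [hPu] using h⟩
  · intro ξ _
    rw [hPid, fderiv_id]
    exact Function.bijective_id

/-- For a globally standard `J`, the member with asymptotic value `b` IS the flat plane. -/
theorem member_eq_flat (J : E4 → E4 →L[ℝ] E4) (R : ℝ) (P Q : E4 →L[ℝ] ℂ) (eP eQ : ℂ →L[ℝ] E4)
    (hPQ : IsCoordFrame P Q eP eQ) (hJP : ∀ x v : E4, P (J x v) = Complex.I * P v)
    (hJQ : ∀ x v : E4, Q (J x v) = Complex.I * Q v) {b : ℂ} {u : ℂ → E4}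
    (hm : IsPencilMember J R P Q b u) : u = fun ξ => eP ξ + eQ b :=
  eq_flat J P Q eP eQ hPQ hJP hJQ hm.1 hm.2.1 hm.2.2.2.2.1 hm.2.2.2.2.2.1

/-- `HasUniqueDisjointMembers` for a globally standard `J`. -/
theorem hasUniqueDisjointMembers (J : E4 → E4 →L[ℝ] E4) (R : ℝ) (P Q : E4 →L[ℝ] ℂ)
    (eP eQ : ℂ →L[ℝ] E4) (hPQ : IsCoordFrame P Q eP eQ)
    (hJP : ∀ x v : E4, P (J x v) = Complex.I * P v)
    (hJQ : ∀ x v : E4, Q (J x v) = Complex.I * Q v) : HasUniqueDisjointMembers J R P Q := by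
  intro b b' u u' hu hu'
  have e := member_eq_flat J R P Q eP eQ hPQ hJP hJQ hu
  have e' := member_eq_flat J R P Q eP eQ hPQ hJP hJQ hu'
  refine ⟨fun hbb => by rw [e, e', hbb], fun hne ξ ξ' h => hne ?_⟩
  rw [e, e'] at h
  have := congrArg Q h
  simp only [map_add, hPQ.2.2.1, hPQ.2.2.2.2.1, zero_add] at this
  exact this

/-- `HasEmbeddedLimits` for a globally standard `J`: a normalised flat-`J`-holomorphic `v` has
`P ∘ v = id` (Liouville), hence is injective and immersed. -/
theorem hasEmbeddedLimits (J : E4 → E4 →L[ℝ] E4) (R : ℝ) (P Q : E4 →L[ℝ] ℂ)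
    (eP eQ : ℂ →L[ℝ] E4) (hPQ : IsCoordFrame P Q eP eQ)
    (hJP : ∀ x v : E4, P (J x v) = Complex.I * P v)
    (hJQ : ∀ x v : E4, Q (J x v) = Complex.I * Q v) : HasEmbeddedLimits J R P Q := by
  intro b u bs v _ _ hv hvJ _ _ h5 h6 _ _
  have e := eq_flat J P Q eP eQ hPQ hJP hJQ hv hvJ h5 h6
  have hm := memberFlat J R P Q eP eQ hPQ hJP hJQ bs
  rw [e]
  exact ⟨hm.2.2.1, hm.2.2.2.1⟩

/-- `HasTransverseMembers` for a globally standard `J`: `range eP ∩ range eQ = 0`. -/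
theorem hasTransverseMembers (J : E4 → E4 →L[ℝ] E4) (R : ℝ) (P Q : E4 →L[ℝ] ℂ)
    (eP eQ : ℂ →L[ℝ] E4) (hPQ : IsCoordFrame P Q eP eQ)
    (hJP : ∀ x v : E4, P (J x v) = Complex.I * P v)
    (hJQ : ∀ x v : E4, Q (J x v) = Complex.I * Q v) : HasTransverseMembers J R P Q := by
  intro b c u w hu hw ξ η _ ζ ζ' h
  have e := member_eq_flat J R P Q eP eQ hPQ hJP hJQ hu
  have e' := member_eq_flat J R Q P eQ eP (PencilDefs.IsCoordFrame.symm hPQ) hJQ hJP hw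
  rw [e, e', ((eP.hasFDerivAt).add_const (eQ b)).fderiv,
    ((eQ.hasFDerivAt).add_const (eP c)).fderiv] at h
  have := congrArg P h
  rwa [hPQ.2.1, hPQ.2.2.2.1] at this

/-- `HasLocalFamilies` for a globally standard `J`: the flat planes are the family. -/
theorem hasLocalFamilies (J : E4 → E4 →L[ℝ] E4) (R : ℝ) (P Q : E4 →L[ℝ] ℂ)
    (eP eQ : ℂ →L[ℝ] E4) (hPQ : IsCoordFrame P Q eP eQ)
    (hJP : ∀ x v : E4, P (J x v) = Complex.I * P v)
    (hJQ : ∀ x v : E4, Q (J x v) = Complex.I * Q v) : HasLocalFamilies J R P Q := by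
  intro b₀ u₀ hu₀
  refine ⟨1, one_pos, fun b ξ => eP ξ + eQ b, ?_, ?_, fun b _ => memberFlat J R P Q eP eQ hPQ hJP hJQ b,
    ?_⟩
  · exact ((eP.contDiff.comp contDiff_snd).add (eQ.contDiff.comp contDiff_fst)).contDiffOn
  · exact (member_eq_flat J R P Q eP eQ hPQ hJP hJQ hu₀).symm
  · intro b _ ξ β ζ h
    rw [((eQ.hasFDerivAt).const_add (eP ξ)).fderiv, ((eP.hasFDerivAt).add_const (eQ b)).fderiv] at h
    have := congrArg Q h
    rwa [hPQ.2.2.2.2.1, hPQ.2.2.1] at this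

/-- **Every frame carries an admissible standard structure** `J₀ = eP ∘ i ∘ P + eQ ∘ i ∘ Q`:
`J₀² = -1` and `J₀` is standard in the frame everywhere (so, as the constant field `fun _ => J₀`, it
is a `C^∞` structure to which `helper_standardModel` applies). -/
theorem exists_standard_structure (P Q : E4 →L[ℝ] ℂ) (eP eQ : ℂ →L[ℝ] E4)
    (hPQ : IsCoordFrame P Q eP eQ) :
    ∃ J₀ : E4 →L[ℝ] E4, (∀ v : E4, J₀ (J₀ v) = -v) ∧ (∀ v : E4, P (J₀ v) = Complex.I * P v) ∧
      (∀ v : E4, Q (J₀ v) = Complex.I * Q v) := by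
  obtain ⟨-, hPeP, hQeP, hPeQ, hQeQ, -⟩ := id hPQ
  refine ⟨eP.comp (((Complex.I • ContinuousLinearMap.id ℂ ℂ).restrictScalars ℝ).comp P) +
    eQ.comp (((Complex.I • ContinuousLinearMap.id ℂ ℂ).restrictScalars ℝ).comp Q), ?_⟩
  have happ : ∀ v : E4, (eP.comp (((Complex.I • ContinuousLinearMap.id ℂ ℂ).restrictScalars ℝ).comp P) +
      eQ.comp (((Complex.I • ContinuousLinearMap.id ℂ ℂ).restrictScalars ℝ).comp Q)) v =
      eP (Complex.I * P v) + eQ (Complex.I * Q v) := fun v => by simp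
  have hP : ∀ v : E4, P (eP (Complex.I * P v) + eQ (Complex.I * Q v)) = Complex.I * P v := fun v => by
    rw [map_add, hPeP, hPeQ, add_zero]
  have hQ : ∀ v : E4, Q (eP (Complex.I * P v) + eQ (Complex.I * Q v)) = Complex.I * Q v := fun v => by
    rw [map_add, hQeP, hQeQ, zero_add]
  simp only [happ]
  refine ⟨fun v => ?_, hP, hQ⟩
  refine PencilDefs.eq_of_apply_eq hPQ ?_ ?_
  · rw [hP, hP, map_neg, ← mul_assoc, Complex.I_mul_I, neg_one_mul]
  · rw [hQ, hQ, map_neg, ← mul_assoc, Complex.I_mul_I, neg_one_mul]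

end StandardModel

/-- **Registered helper `helper_standardModel` (non-vacuity of the four deep predicates).** For an
almost complex structure standard in the frame EVERYWHERE (such structures exist for every frame:
`StandardModel.exists_standard_structure`), all four deep predicates of the line hold — with the flat planes
as the members, the flat local families, and `P ∘ v = id` for normalised limits. -/
theorem helper_standardModel (J : E4 → E4 →L[ℝ] E4) (R : ℝ) (P Q : E4 →L[ℝ] ℂ)
    (eP eQ : ℂ →L[ℝ] E4) (hPQ : IsCoordFrame P Q eP eQ)
    (hJP : ∀ x v : E4, P (J x v) = Complex.I * P v)
    (hJQ : ∀ x v : E4, Q (J x v) = Complex.I * Q v) :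
    HasLocalFamilies J R P Q ∧ HasUniqueDisjointMembers J R P Q ∧ HasEmbeddedLimits J R P Q ∧
      HasTransverseMembers J R P Q :=
  ⟨StandardModel.hasLocalFamilies J R P Q eP eQ hPQ hJP hJQ,
    StandardModel.hasUniqueDisjointMembers J R P Q eP eQ hPQ hJP hJQ,
    StandardModel.hasEmbeddedLimits J R P Q eP eQ hPQ hJP hJQ,
    StandardModel.hasTransverseMembers J R P Q eP eQ hPQ hJP hJQ⟩

end Summit.SmoothPoincare4.SmoothPoincare4.Cruxes.TameOrBrodyR4.Sketch
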